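import Mathlib
import Literature.MathematicalPhysics.QuantumFieldTheory.Balaban1983to89.B1Sect3Statements

/-!
# `BalabanImbrieJaffe1984to88.BIJ88Perturbative341` — T. Bałaban, J. Imbrie, A. Jaffe, *Effective action and cluster
properties of the abelian Higgs model*, Commun. Math. Phys. **114** (1988) 257–315 [BalabanImbrieJaffe1988]: Sect. 3
"The First Renormalization Step", displays (3.40)–(3.41) p. 272 — the resummed small-field integral, the perturbative
part `𝒫̃₁` of the effective action as Taylor coefficients of `log z_t` at `t = 0`, and the remainder as a truncated
expectation in the interacting fluctuation measure with parameter `t ∈ [0, 1]` (Taylor's theorem)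

statement-level skeleton of published theorems with citation tags; proofs where landed; nothing here is a
claim about the Yang–Mills mass gap

PDF held: `paper:balaban1988-cmp114-bij-abelian-higgs-effective-action` (journal page = PDF page + 256); PDF pp. 15–16
(journal 271–272) rendered with poppler (×2.5) and read as images; the displays and sentences below are quoted verbatim.

CITATION HEADER (lean-in-tree rule).  lit-balaban TYPED SKELETON, PHASE 2 (HOME `run/shared/lean/pub/lit-balaban/`); proof
seat p27, generation 2 (unit `lit-balaban-p27`); rows taken from the C2 §§1–4 owner's list of free rows (`lit-balaban-r18`,
HOME/STATUS 2026-08-21T01:19:00Z (c)); referee group ref-5.  WHAT IS REPRODUCED: SKELETON rows **C2.Eq3.40** and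
**C2.Eq3.41** (first display; the label (3.41) is printed twice on p. 272 — transcript note T5 of `lit-balaban-r18/ROWS-C2.md`).

THE PRINTED TEXT (verbatim, p. 272 [PDF 16]).  *"The resummed integral in Λ₁₂⁽⁰⁾ is written as
  z_F(Λ₁₂⁽⁰⁾) = (z_F(Λ₁₂⁽⁰⁾)/z(Λ₁₂⁽⁰⁾)) exp(log z(Λ₁₂⁽⁰⁾)).   (3.40)
The first factor is the expectation of the portion of the observable in Λ₁₂⁽⁰⁾ in the interacting fluctuation measure.
The exponent is the effective action, which is calculated as follows. We interpolate the interaction V⁽⁰⁾ − V⁽⁰⁾_const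
with a prefactor t. At the same time we interpolate away the characteristic functions χ′ in Λ₁₂⁽⁰⁾. The perturbative
part of the effective action is
  𝒫̃₁(Λ₁₂⁽⁰⁾) = Σ_{α=1}^{n̄} − (1/α!) (d^α/dt^α) log z_t(Λ₁₂⁽⁰⁾)|_{t=0},   (3.41)
and the remainder involves truncated expectation values in the interacting fluctuation measure with parameter
t ∈ [0, 1]."*  Earlier on p. 272: *"… all other terms are uniformly small (bounded by a power of e₀) because of the
restrictions on the fields."*

WHAT IS TYPED AND PROVED.
§1 (3.40): `eq340` — for `z > 0`, `z_F = (z_F/z)·exp(log z)` (the printed resummation identity; the content is `z > 0`).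
§2 (3.41) OVER AN ABSTRACT PARAMETER FAMILY `logz : ℝ → ℝ` (= `t ↦ log z_t(Λ₁₂⁽⁰⁾)`, both interpolations included):
  `pertPart n̄ logz := Σ_{α=1}^{n̄} −(1/α!)·(iteratedDeriv α logz 0)` — (3.41) verbatim — and the sentence after (3.41)
  PROVED as TAYLOR'S THEOREM for a `C^{n̄+1}` family: `effectiveAction_taylor_lagrange` (∃ θ ∈ (0,1),
  `−logz 1 = −logz 0 + 𝒫̃₁ − (1/(n̄+1)!)·logz^{(n̄+1)}(θ)`, Mathlib `taylor_mean_remainder_lagrange_iteratedDeriv`) and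
  `effectiveAction_taylor_integral` (`−logz 1 = −logz 0 + 𝒫̃₁ − ∫₀¹ ((1−t)^{n̄}/n̄!)·logz^{(n̄+1)}(t) dt`, Mathlib
  `taylor_integral_remainder`): the remainder IS the `(n̄+1)`-st `t`-derivative of `log z_t` — the truncated
  expectation of order `n̄+1` — at a parameter `t ∈ [0,1]`.
§3 THE INTERPOLATED INTERACTION.  For a finite measure `μ` (in print: the small-field Gaussian measure
  `dμ_{Λ₁₀}(A⁽⁰⁾″, φ⁽⁰⁾″)` times the characteristic functions and observable factors of (3.38), all non-negative and
  bounded) and an interaction `W = V⁽⁰⁾ − V⁽⁰⁾_const` BOUNDED on the support (the quoted "uniformly small because of the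
  restrictions on the fields"; the bound is a qualitative binder): `z_t = ∫ e^{−tW} dμ` IS Mathlib's moment generating
  function `ProbabilityTheory.mgf (−W) μ t` (`zt_eq_mgf`) and `log z_t` its cumulant generating function `cgf`;
  `integrableExpSet_eq_univ` (all real `t` are admissible), `contDiff_cgf` (`log z_t` is `C^∞`, indeed analytic, in `t`);
  hence **`eq341_lagrange` / `eq341_integral`**: (3.41) with its remainder, for every `n̄`, for the ACTUAL interacting
  measure.  The truncated expectations at parameter `t` of orders 1 and 2 are identified with Mathlib / the B1 cell
  file: `truncExp_one` (`(d/dt) log z_t = ⟨−W⟩_t`, the mean in the tilted = interacting measure with parameter `t`,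
  Mathlib `deriv_cgf`) and `truncExp_two` (`(d/dt)² log z_t = B1Sect3Statements.trunc2 ⟨−W⟩_t ⟨W²⟩_t`
  = the printed truncated expectation `⟨V²⟩^T = ⟨V²⟩ − ⟨V⟩²` of [Balaban1982Higgs1] (3.23), Mathlib `iteratedDeriv_two_cgf`).
NOT TYPED HERE: the displays (3.38)/(3.39) (polymer form, cluster expansion), the second display labelled (3.41)
(`V_const + 𝒫̃₁ = 𝒫^L_{1,loc} + Σ_X W₆⁽⁰⁾″(X)`, replacement of the Dirichlet covariances by the localized ones — by
assertion in print), and the identification of `μ`, `W` with the BIJ carriers (rows C2.Eq3.38/3.39, owner files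
`BIJ88Sect3Statements`, `BIJ88Sect4Statements`); the interpolation of the characteristic functions `χ′` is covered by §2
(any `C^{n̄+1}` family) but not by the exponential family of §3.  No `sorry`, no axiom beyond the standard three.
Related tree material: `Balaban1983to89/B14InterpolationMeasure` (same seat) — the first-order (`n̄ = 0`, fundamental
theorem of calculus) version of this mechanism for [Balaban1988Convergent] (3.26)–(3.32).
-/

noncomputable section

open _root_.MeasureTheory _root_.Set _root_.Filter _root_.ProbabilityTheory _root_.Real
open scoped Topology BigOperators Nat

namespace Literature.MathematicalPhysics.QuantumFieldTheory.BalabanImbrieJaffe1984to88.BIJ88Perturbative341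

open Literature.MathematicalPhysics.QuantumFieldTheory.Balaban1983to89 (B1Sect3Statements.trunc2)

/-! ## §1  (3.40): the resummation identity -/

/-- **(3.40) p. 272**, verbatim: *"z_F(Λ₁₂⁽⁰⁾) = (z_F(Λ₁₂⁽⁰⁾)/z(Λ₁₂⁽⁰⁾)) exp(log z(Λ₁₂⁽⁰⁾))"* — for a positive
normalization `z > 0` (the small-field partition function) and any `z_F` (the same integral with the observable).
[cite: BalabanImbrieJaffe1988, (3.40) p.272] -/
theorem eq340 {z : ℝ} (hz : 0 < z) (zF : ℝ) : zF = zF / z * Real.exp (Real.log z) := by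
  rw [Real.exp_log hz, div_mul_cancel₀ zF hz.ne']

/-! ## §2  (3.41) over an abstract parameter family `t ↦ log z_t` -/

/-- **(3.41) p. 272 (first display)**, verbatim: *"𝒫̃₁(Λ₁₂⁽⁰⁾) = Σ_{α=1}^{n̄} − (1/α!) (d^α/dt^α) log z_t(Λ₁₂⁽⁰⁾)|_{t=0}"*
— the perturbative part of the effective action, typed over the parameter family `logz = (t ↦ log z_t(Λ₁₂⁽⁰⁾))`.
[cite: BalabanImbrieJaffe1988, (3.41) p.272] -/
def pertPart (nbar : ℕ) (logz : ℝ → ℝ) : ℝ :=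
  ∑ α ∈ Finset.range nbar, -((1 / ((α + 1) ! : ℝ)) * iteratedDeriv (α + 1) logz 0)

/-- Unfolding of `pertPart`: the sum over `α = 1, …, n̄` written with the shifted index `α ↦ α + 1` over `range n̄`.
[cite: BalabanImbrieJaffe1988, (3.41) p.272] -/
theorem pertPart_def (nbar : ℕ) (logz : ℝ → ℝ) :
    pertPart nbar logz = ∑ α ∈ Finset.range nbar, -((1 / ((α + 1) ! : ℝ)) * iteratedDeriv (α + 1) logz 0) := rfl

/-- `𝒫̃₁` at order `n̄ + 1` adds the term `−(1/(n̄+1)!)·logz^{(n̄+1)}(0)`. [cite: BalabanImbrieJaffe1988, (3.41) p.272] -/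
theorem pertPart_succ (nbar : ℕ) (logz : ℝ → ℝ) :
    pertPart (nbar + 1) logz = pertPart nbar logz - (1 / ((nbar + 1) ! : ℝ)) * iteratedDeriv (nbar + 1) logz 0 := by
  rw [pertPart, Finset.sum_range_succ, ← pertPart, sub_eq_add_neg]

/-- The Taylor polynomial of order `n̄` of `logz` at `0`, evaluated at `1`, is `logz 0 − 𝒫̃₁`:
`Σ_{α=0}^{n̄} (1/α!) logz^{(α)}(0) = logz 0 − pertPart n̄ logz`. [cite: BalabanImbrieJaffe1988, (3.41) p.272] -/
theorem sum_range_taylor_eq (nbar : ℕ) (logz : ℝ → ℝ) :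
    ∑ α ∈ Finset.range (nbar + 1), (1 / (α ! : ℝ)) * iteratedDeriv α logz 0 = logz 0 - pertPart nbar logz := by
  rw [pertPart, Finset.sum_neg_distrib, sub_neg_eq_add, Finset.sum_range_succ', add_comm]
  simp

/-- `[0, 1]` (as Mathlib's unordered interval `uIcc 0 1`) is a set of unique differentiability.
[cite: BalabanImbrieJaffe1988, (3.41) p.272] -/
theorem uniqueDiffOn_uIcc01 : UniqueDiffOn ℝ (uIcc (0:ℝ) 1) := uniqueDiffOn_Icc (by norm_num)

/-- For a `C^{n̄}`-family (on a neighbourhood of `[0,1]`, here: on `ℝ`) Mathlib's within-`[0,1]` Taylor polynomial at `0`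
evaluated at `1` is `logz 0 − 𝒫̃₁`. [cite: BalabanImbrieJaffe1988, (3.41) p.272] -/
theorem taylorWithinEval_eq {nbar : ℕ} {logz : ℝ → ℝ} (hf : ContDiff ℝ nbar logz) :
    taylorWithinEval logz nbar (uIcc (0:ℝ) 1) 0 1 = logz 0 - pertPart nbar logz := by
  rw [taylor_within_apply, ← sum_range_taylor_eq]
  refine Finset.sum_congr rfl fun α hα => ?_
  have hα' : (α : ℕ∞) ≤ nbar := by
    exact_mod_cast Nat.lt_succ_iff.1 (Finset.mem_range.1 hα)
  rw [sub_zero, one_pow, mul_one, smul_eq_mul, one_div,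
    iteratedDerivWithin_eq_iteratedDeriv uniqueDiffOn_uIcc01 (hf.of_le (by exact_mod_cast hα')).contDiffAt
      left_mem_uIcc]

/-- **The sentence after (3.41), Lagrange form**: for a `C^{n̄+1}` parameter family `t ↦ log z_t`, the effective action
`−log z₁` equals `−log z₀ + 𝒫̃₁` plus a remainder which is (minus `1/(n̄+1)!` times) the `(n̄+1)`-st `t`-derivative of
`log z_t` — the truncated expectation of order `n̄+1` — at some parameter `θ ∈ (0,1)`:
*"the remainder involves truncated expectation values in the interacting fluctuation measure with parameter t ∈ [0,1]"*.
(Taylor's theorem, Mathlib `taylor_mean_remainder_lagrange_iteratedDeriv`.) [cite: BalabanImbrieJaffe1988, (3.41) p.272] -/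
theorem effectiveAction_taylor_lagrange {nbar : ℕ} {logz : ℝ → ℝ} (hf : ContDiff ℝ (nbar + 1) logz) :
    ∃ θ ∈ Ioo (0:ℝ) 1,
      -logz 1 = -logz 0 + pertPart nbar logz - iteratedDeriv (nbar + 1) logz θ / ((nbar + 1)! : ℝ) := by
  obtain ⟨θ, hθ, h⟩ := taylor_mean_remainder_lagrange_iteratedDeriv (f := logz) (x₀ := (0:ℝ)) (x := 1) (n := nbar)
    zero_ne_one hf.contDiffOn
  rw [taylorWithinEval_eq (hf.of_le (by exact_mod_cast Nat.le_succ nbar))] at h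
  refine ⟨θ, by simpa [uIoo] using hθ, ?_⟩
  rw [sub_zero, one_pow, mul_one] at h
  linarith

/-- **The sentence after (3.41), integral form**: for a `C^{n̄+1}` parameter family,
`−log z₁ = −log z₀ + 𝒫̃₁ − ∫₀¹ ((1−t)^{n̄}/n̄!) · (d/dt)^{n̄+1} log z_t dt` — the remainder is an average over the
parameters `t ∈ [0,1]` of the `(n̄+1)`-st truncated expectation. (Mathlib `taylor_integral_remainder`.)
[cite: BalabanImbrieJaffe1988, (3.41) p.272] -/
theorem effectiveAction_taylor_integral {nbar : ℕ} {logz : ℝ → ℝ} (hf : ContDiff ℝ (nbar + 1) logz) :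
    -logz 1 = -logz 0 + pertPart nbar logz
      - ∫ t in (0:ℝ)..1, ((1 - t) ^ nbar / (nbar ! : ℝ)) * iteratedDeriv (nbar + 1) logz t := by
  have h := taylor_integral_remainder (f := logz) (x₀ := (0:ℝ)) (x := 1) (n := nbar) hf.contDiffOn
  rw [taylorWithinEval_eq (hf.of_le (by exact_mod_cast Nat.le_succ nbar))] at h
  have hI : ∫ t in (0:ℝ)..1, ((1 - t) ^ nbar / (nbar ! : ℝ)) • iteratedDerivWithin (nbar + 1) logz (uIcc (0:ℝ) 1) t
      = ∫ t in (0:ℝ)..1, ((1 - t) ^ nbar / (nbar ! : ℝ)) * iteratedDeriv (nbar + 1) logz t := by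
    refine intervalIntegral.integral_congr fun t ht => ?_
    rw [smul_eq_mul, iteratedDerivWithin_eq_iteratedDeriv uniqueDiffOn_uIcc01 hf.contDiffAt ht]
  rw [hI] at h
  linarith

/-! ## §3  The interpolated interaction: `z_t = ∫ e^{−tW} dμ`, `W = V⁽⁰⁾ − V⁽⁰⁾_const` bounded, `μ` finite -/

section Interaction

variable {Ω : Type*} [MeasurableSpace Ω] {μ : Measure Ω} {W : Ω → ℝ} {K : ℝ}

/-- The interpolated small-field integral `z_t = ∫ e^{−tW} dμ` (*"We interpolate the interaction V⁽⁰⁾ − V⁽⁰⁾_const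
with a prefactor t"*) IS the moment generating function of `−W` under `μ` (Mathlib `ProbabilityTheory.mgf`); its
logarithm `log z_t` is the cumulant generating function `cgf (−W) μ t`. [cite: BalabanImbrieJaffe1988, (3.41) p.272] -/
theorem zt_eq_mgf (μ : Measure Ω) (W : Ω → ℝ) (t : ℝ) :
    ∫ ω, Real.exp (-(t * W ω)) ∂μ = mgf (fun ω => -W ω) μ t := by
  simp [mgf, mul_neg]

/-- For an interaction bounded on the support (*"uniformly small … because of the restrictions on the fields"*) and a
finite measure, `e^{−tW}` is integrable for EVERY real `t`: Mathlib's `integrableExpSet (−W) μ = univ`.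
[cite: BalabanImbrieJaffe1988, (3.41) p.272] -/
theorem integrableExpSet_eq_univ [IsFiniteMeasure μ] (hW : AEStronglyMeasurable W μ) (hK : ∀ᵐ ω ∂μ, |W ω| ≤ K) :
    integrableExpSet (fun ω => -W ω) μ = univ := by
  refine eq_univ_of_forall fun t => ?_
  change Integrable (fun ω => Real.exp (t * -W ω)) μ
  refine Integrable.mono' (integrable_const (Real.exp (|t| * K)))
    (Real.continuous_exp.comp_aestronglyMeasurable (hW.neg.const_mul t)) ?_
  filter_upwards [hK] with ω hω
  rw [Real.norm_eq_abs, abs_of_nonneg (Real.exp_nonneg _), Real.exp_le_exp]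
  calc t * -W ω ≤ |t * -W ω| := le_abs_self _
    _ = |t| * |W ω| := by rw [abs_mul, abs_neg]
    _ ≤ |t| * K := mul_le_mul_of_nonneg_left hω (abs_nonneg t)

/-- Every real parameter lies in the interior of the admissible set. [cite: BalabanImbrieJaffe1988, (3.41) p.272] -/
theorem mem_interior_integrableExpSet [IsFiniteMeasure μ] (hW : AEStronglyMeasurable W μ)
    (hK : ∀ᵐ ω ∂μ, |W ω| ≤ K) (t : ℝ) : t ∈ interior (integrableExpSet (fun ω => -W ω) μ) := by
  rw [integrableExpSet_eq_univ hW hK, interior_univ]; exact mem_univ t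

/-- `t ↦ log z_t` is smooth of every order (indeed analytic, Mathlib `analyticAt_cgf`) — so (3.41) makes sense for every
`n̄`. [cite: BalabanImbrieJaffe1988, (3.41) p.272] -/
theorem contDiff_cgf [IsFiniteMeasure μ] (hW : AEStronglyMeasurable W μ) (hK : ∀ᵐ ω ∂μ, |W ω| ≤ K)
    (n : ℕ) : ContDiff ℝ n (cgf (fun ω => -W ω) μ) := by
  rw [← contDiffOn_univ]
  have h : AnalyticOnNhd ℝ (cgf (fun ω => -W ω) μ) univ := fun t _ =>
    analyticAt_cgf (mem_interior_integrableExpSet hW hK t)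
  exact h.contDiffOn_of_completeSpace

/-- **(3.41) with its remainder, FOR THE INTERACTING MEASURE (Lagrange form)**: for a finite measure `μ` and a bounded
interaction `W`, with `z_t = ∫ e^{−tW} dμ` and every order `n̄`: there is a parameter `θ ∈ (0,1)` with
`−log z₁ = −log z₀ + 𝒫̃₁ − (1/(n̄+1)!)·(d/dt)^{n̄+1} log z_t |_{t=θ}`.
[cite: BalabanImbrieJaffe1988, (3.41) p.272] -/
theorem eq341_lagrange [IsFiniteMeasure μ] (hW : AEStronglyMeasurable W μ) (hK : ∀ᵐ ω ∂μ, |W ω| ≤ K)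
    (nbar : ℕ) :
    ∃ θ ∈ Ioo (0:ℝ) 1, -cgf (fun ω => -W ω) μ 1 = -cgf (fun ω => -W ω) μ 0
      + pertPart nbar (cgf (fun ω => -W ω) μ)
      - iteratedDeriv (nbar + 1) (cgf (fun ω => -W ω) μ) θ / ((nbar + 1)! : ℝ) :=
  effectiveAction_taylor_lagrange (contDiff_cgf hW hK (nbar + 1))

/-- **(3.41) with its remainder, FOR THE INTERACTING MEASURE (integral form)**.
[cite: BalabanImbrieJaffe1988, (3.41) p.272] -/
theorem eq341_integral [IsFiniteMeasure μ] (hW : AEStronglyMeasurable W μ) (hK : ∀ᵐ ω ∂μ, |W ω| ≤ K)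
    (nbar : ℕ) :
    -cgf (fun ω => -W ω) μ 1 = -cgf (fun ω => -W ω) μ 0 + pertPart nbar (cgf (fun ω => -W ω) μ)
      - ∫ t in (0:ℝ)..1, ((1 - t) ^ nbar / (nbar ! : ℝ)) * iteratedDeriv (nbar + 1) (cgf (fun ω => -W ω) μ) t :=
  effectiveAction_taylor_integral (contDiff_cgf hW hK (nbar + 1))

/-- When the un-interpolated integral is normalized (`μ` a probability measure, `z₀ = 1`), `log z₀ = 0` and (3.41) reads
`−log z₁ = 𝒫̃₁ + remainder`. [cite: BalabanImbrieJaffe1988, (3.41) p.272] -/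
theorem eq341_lagrange_of_prob [IsProbabilityMeasure μ] (hW : AEStronglyMeasurable W μ) (hK : ∀ᵐ ω ∂μ, |W ω| ≤ K)
    (nbar : ℕ) :
    ∃ θ ∈ Ioo (0:ℝ) 1, -cgf (fun ω => -W ω) μ 1 = pertPart nbar (cgf (fun ω => -W ω) μ)
      - iteratedDeriv (nbar + 1) (cgf (fun ω => -W ω) μ) θ / ((nbar + 1)! : ℝ) := by
  obtain ⟨θ, hθ, h⟩ := eq341_lagrange hW hK nbar
  exact ⟨θ, hθ, by rw [h, cgf_zero]; ring⟩

/-- THE TRUNCATED EXPECTATION OF ORDER 1 AT PARAMETER `t`: `(d/dt) log z_t = ∫(−W)e^{−tW}dμ / ∫e^{−tW}dμ = ⟨−W⟩_t`,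
the mean in the interacting fluctuation measure with parameter `t` (Mathlib `deriv_cgf`).
[cite: BalabanImbrieJaffe1988, (3.41) p.272] -/
theorem truncExp_one [IsFiniteMeasure μ] (hW : AEStronglyMeasurable W μ) (hK : ∀ᵐ ω ∂μ, |W ω| ≤ K) (t : ℝ) :
    deriv (cgf (fun ω => -W ω) μ) t
      = (∫ ω, -W ω * Real.exp (t * -W ω) ∂μ) / mgf (fun ω => -W ω) μ t :=
  deriv_cgf (mem_interior_integrableExpSet hW hK t)

/-- THE TRUNCATED EXPECTATION OF ORDER 2 AT PARAMETER `t` is the truncated expectation `⟨V²⟩^T = ⟨V²⟩ − ⟨V⟩²` of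
[Balaban1982Higgs1] (3.23) (`B1Sect3Statements.trunc2`) of the first two moments of `−W` in the interacting measure
with parameter `t`: `(d/dt)² log z_t = trunc2 ⟨−W⟩_t ⟨W²⟩_t` (Mathlib `iteratedDeriv_two_cgf`).
[cite: BalabanImbrieJaffe1988, (3.41) p.272] -/
theorem truncExp_two [IsFiniteMeasure μ] (hW : AEStronglyMeasurable W μ) (hK : ∀ᵐ ω ∂μ, |W ω| ≤ K) (t : ℝ) :
    iteratedDeriv 2 (cgf (fun ω => -W ω) μ) t
      = B1Sect3Statements.trunc2
          ((∫ ω, -W ω * Real.exp (t * -W ω) ∂μ) / mgf (fun ω => -W ω) μ t)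
          ((∫ ω, (-W ω) ^ 2 * Real.exp (t * -W ω) ∂μ) / mgf (fun ω => -W ω) μ t) := by
  rw [B1Sect3Statements.trunc2, iteratedDeriv_two_cgf (mem_interior_integrableExpSet hW hK t),
    deriv_cgf (mem_interior_integrableExpSet hW hK t)]

/-- FIRST-ORDER PERTURBATION THEORY: for `n̄ = 1`, `𝒫̃₁ = −(d/dt) log z_t|_{t=0} = ∫ W dμ / μ(Ω)` — the perturbative
part of the effective action is the interaction averaged in the un-interpolated (`t = 0`) measure.
[cite: BalabanImbrieJaffe1988, (3.41) p.272] -/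
theorem pertPart_one [IsFiniteMeasure μ] (hW : AEStronglyMeasurable W μ) (hK : ∀ᵐ ω ∂μ, |W ω| ≤ K) :
    pertPart 1 (cgf (fun ω => -W ω) μ) = (∫ ω, W ω ∂μ) / μ.real univ := by
  rw [pertPart, Finset.sum_range_one, zero_add, Nat.factorial_one, Nat.cast_one,
    div_one, one_mul, iteratedDeriv_one, truncExp_one hW hK 0]
  simp [mgf_zero', integral_neg, neg_div]

end Interaction

end Literature.MathematicalPhysics.QuantumFieldTheory.BalabanImbrieJaffe1984to88.BIJ88Perturbative341
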